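import Literature.AlgebraicGeometry.HodgeTheory.HomComplexSigmaQuasiIso
import HarnessLib

/-!
# Complex-level `I`-semiregularity is independent of the amplitude window, and transports along quasi-isomorphisms
# of strictly perfect complexes with independent windows

PROMOTED LITERATURE COPY (librarian protocol (b); DEFREQ-CoherentISemiregular, cell pub-hsemireg) of §§1–2 (generic part only) of
`Summits/Ventures/HSemireg/PerfectComplexSigmaQuasiIso.lean` (its §3, about the venture's admissibility notion `sigmaAdmissible`, is NOT
copied); namespace now `Literature.AlgebraicGeometry.HodgeTheory.HomComplex`, declaration names kept.

* §1 WINDOW INDEPENDENCE: the unit `𝒪_X[0] ⟶ 𝓗om•(K•, K•)` (`HomComplex.unit X K a b`, `HomComplexUnit.lean`), hence `σ_q`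
  (`HomComplex.sigmaC X K a b hK q`, `HomComplexSigma.lean`) and the predicates `IsISemiregularC` / `IsSemiregularC`, do not depend on
  the amplitude window `[a, b]` chosen for `K•` (`unit_eq_of_window`, `sigmaC_eq_of_window`, `isISemiregularC_iff_of_window`): the unit is
  the sum of `a ↦ a · 𝟙_{K^p}` over the window, and the summands outside the support of `K•` vanish. (So the `∃`-window hypothesis of
  `BuchweitzFlenner2003_variationalHodge_ISemiregular_coherent` does not depend on the witness `a`.)
* §2 TRANSPORT ALONG QUASI-ISOMORPHISMS WITH INDEPENDENT WINDOWS: `sigmaC_eq_of_quasiIso'`, `isISemiregularC_iff_of_quasiIso'`,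
  `isSemiregularC_iff_of_quasiIso'` (from `HomComplexSigmaQuasiIso.lean` through the common window `[min a₁ a₂, max b₁ b₂]`) — with
  `isISemiregularC_iff_of_roof` there, this is the statement that `I`-semiregularity [BF03, §5] is a property of the object of `D^b(X)`
  (of the coherent sheaf / perfect complex), not of the chosen strictly perfect model. Everything is PROVED; no definition, no named fact.

## References
* [BuchweitzFlenner2003] R.-O. Buchweitz, H. Flenner, Compositio Math. 137 (2003), Def. 4.1 (arXiv p. 20 L47–57) and §5 (arXiv p. 25 L52–62).
-/

noncomputable section

open CategoryTheory CategoryTheory.Limits CategoryTheory.Category AlgebraicGeometry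

namespace Literature.AlgebraicGeometry.HodgeTheory

open Literature.AlgebraicGeometry.Modules Literature.AlgebraicGeometry.Motives

namespace HomComplex

/-! ## §1 Window independence of the unit and of `σ_q` -/

section Window

universe w

variable (Y : Scheme.{w}) (E : CochainComplex Y.Modules ℤ)

/-- A unit summand `𝒪 ⟶ 𝓔nd(E^{-i}) ⟶ 𝓗om•(E•, E•)^0` vanishes when `E^{-i} = 0`. [cite: Weibel1994, 2.7.4–2.7.5 (Hom cochain complex)] -/
theorem unitSummand_eq_zero_of_isZero (i : ℤ) (h : IsZero (E.X (-i))) : unitSummand Y E i = 0 := by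
  change sheafHomUnit (E.X (-i)) ≫ ι Y E E (-i) i 0 _ = 0
  rw [(isZero_sheafHom_of_isZero h (E.X (-i))).eq_of_tgt (sheafHomUnit (E.X (-i))) 0, zero_comp]

/-- The degree-`0` unit over a larger window equals the one over `[a, b] ∋ supp E•`. [cite: Weibel1994, 2.7.4–2.7.5 (Hom cochain complex)] -/
theorem unitDeg₀_eq_of_le (a b a' b' : ℤ) (ha : a' ≤ a) (hb : b ≤ b') [E.IsStrictlyGE a] [E.IsStrictlyLE b] :
    unitDeg₀ Y E a' b' = unitDeg₀ Y E a b := by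
  unfold unitDeg₀
  symm
  refine Finset.sum_subset (Finset.Icc_subset_Icc (by lia) (by lia)) fun j hj hj' => ?_
  simp only [Finset.mem_Icc, not_and_or, not_le] at hj hj'
  rcases hj' with hj' | hj'
  · exact unitSummand_eq_zero_of_isZero Y E j (E.isZero_of_isStrictlyLE b _ (by lia))
  · exact unitSummand_eq_zero_of_isZero Y E j (E.isZero_of_isStrictlyGE a _ (by lia))

/-- The unit over a larger window equals the one over `[a, b]`. [cite: Weibel1994, 2.7.4–2.7.5 (Hom cochain complex)] -/
theorem unit_eq_of_le (a b a' b' : ℤ) (ha : a' ≤ a) (hb : b ≤ b') [E.IsStrictlyGE a] [E.IsStrictlyLE b]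
    [E.IsStrictlyGE a'] [E.IsStrictlyLE b'] : unit Y E a' b' = unit Y E a b := by
  refine HomologicalComplex.from_single_hom_ext ?_
  rw [unit, unit, HomologicalComplex.mkHomFromSingle_f, HomologicalComplex.mkHomFromSingle_f,
    unitDeg₀_eq_of_le Y E a b a' b' ha hb]

/-- **The unit `𝒪_X[0] ⟶ 𝓗om•(E•, E•)` does not depend on the amplitude window.** [cite: Weibel1994, 2.7.4–2.7.5 (Hom cochain complex)] -/
theorem unit_eq_of_window (a b a' b' : ℤ) [E.IsStrictlyGE a] [E.IsStrictlyLE b] [E.IsStrictlyGE a'] [E.IsStrictlyLE b'] :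
    unit Y E a' b' = unit Y E a b := by
  haveI := E.isStrictlyGE_of_ge (min a a') a (min_le_left _ _)
  haveI := E.isStrictlyLE_of_le b (max b b') (le_max_left _ _)
  rw [← unit_eq_of_le Y E a b (min a a') (max b b') (min_le_left _ _) (le_max_left _ _),
    unit_eq_of_le Y E a' b' (min a a') (max b b') (min_le_right _ _) (le_max_right _ _)]

end Window

section SigmaWindow

universe w₁ u₁

variable {S : Type u₁} [CommRing S] (X : Over (Spec (CommRingCat.of S))) [HasDerivedCategory.{w₁} X.left.Modules]
  (K : CochainComplex X.left.Modules ℤ) (a b a' b' : ℤ)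
  [K.IsStrictlyGE a] [K.IsStrictlyLE b] [K.IsStrictlyGE a'] [K.IsStrictlyLE b']
  (hK : ∀ p, IsFiniteLocallyFree (K.X p))

/-- **`σ_q` does not depend on the amplitude window** chosen for the strictly perfect complex. [cite: BuchweitzFlenner2003, Def. 4.1] -/
theorem sigmaC_eq_of_window (q : ℕ) (x : ShiftedHom (DerivedCategory.Q.obj K) (DerivedCategory.Q.obj K) (2 : ℤ)) :
    sigmaC X K a' b' hK q x = sigmaC X K a b hK q x := by
  rw [sigmaC, sigmaC, unitQ, unitQ, unit_eq_of_window X.left K a b a' b']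
  rfl

/-- `I`-semiregularity does not depend on the amplitude window. [cite: BuchweitzFlenner2003, §5 (I-semiregular)] -/
theorem isISemiregularC_iff_of_window (I : Set ℕ) : IsISemiregularC X K a' b' hK I ↔ IsISemiregularC X K a b hK I := by
  have h : (fun (x : ShiftedHom (DerivedCategory.Q.obj K) (DerivedCategory.Q.obj K) (2 : ℤ)) (q : I) => sigmaC X K a' b' hK q x) =
      fun (x : ShiftedHom (DerivedCategory.Q.obj K) (DerivedCategory.Q.obj K) (2 : ℤ)) (q : I) => sigmaC X K a b hK q x := by
    funext x; funext q
    exact sigmaC_eq_of_window X K a b a' b' hK q x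
  rw [IsISemiregularC, IsISemiregularC, h]

/-- `q`-semiregularity does not depend on the amplitude window. [cite: BuchweitzFlenner2003, Def. 4.1] -/
theorem isSemiregularC_iff_of_window (q : ℕ) : IsSemiregularC X K a' b' hK q ↔ IsSemiregularC X K a b hK q := by
  rw [isSemiregularC_iff_isISemiregularC_singleton, isSemiregularC_iff_isISemiregularC_singleton]
  exact isISemiregularC_iff_of_window X K a b a' b' hK {q}

end SigmaWindow

/-! ## §2 Transport along quasi-isomorphisms, independent windows -/

section QuasiIsoWindows

universe w₁ u₁

variable {S : Type u₁} [CommRing S] (X : Over (Spec (CommRingCat.of S))) [HasDerivedCategory.{w₁} X.left.Modules]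
  {K₁ K₂ : CochainComplex X.left.Modules ℤ} (a₁ b₁ a₂ b₂ : ℤ)
  [K₁.IsStrictlyGE a₁] [K₁.IsStrictlyLE b₁] [K₂.IsStrictlyGE a₂] [K₂.IsStrictlyLE b₂]
  (hK₁ : ∀ p, IsFiniteLocallyFree (K₁.X p)) (hK₂ : ∀ p, IsFiniteLocallyFree (K₂.X p)) (f : K₁ ⟶ K₂) [QuasiIso f]

/-- `σ_q(K₁•)(x) = σ_q(K₂•)(x')` for classes intertwined by a quasi-isomorphism `f`, each complex in its own window.
[cite: BuchweitzFlenner2003, Def. 4.1] -/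
theorem sigmaC_eq_of_quasiIso' (q : ℕ) (x : ShiftedHom (DerivedCategory.Q.obj K₁) (DerivedCategory.Q.obj K₁) (2 : ℤ))
    (x' : ShiftedHom (DerivedCategory.Q.obj K₂) (DerivedCategory.Q.obj K₂) (2 : ℤ))
    (h : x.comp (ShiftedHom.mk₀ (0 : ℤ) rfl (DerivedCategory.Q.map f)) (zero_add 2) =
      (ShiftedHom.mk₀ (0 : ℤ) rfl (DerivedCategory.Q.map f)).comp x' (add_zero 2)) :
    sigmaC X K₁ a₁ b₁ hK₁ q x = sigmaC X K₂ a₂ b₂ hK₂ q x' := by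
  haveI := K₁.isStrictlyGE_of_ge (min a₁ a₂) a₁ (min_le_left _ _)
  haveI := K₁.isStrictlyLE_of_le b₁ (max b₁ b₂) (le_max_left _ _)
  haveI := K₂.isStrictlyGE_of_ge (min a₁ a₂) a₂ (min_le_right _ _)
  haveI := K₂.isStrictlyLE_of_le b₂ (max b₁ b₂) (le_max_right _ _)
  rw [sigmaC_eq_of_window X K₁ (min a₁ a₂) (max b₁ b₂) a₁ b₁ hK₁,
    sigmaC_eq_of_window X K₂ (min a₁ a₂) (max b₁ b₂) a₂ b₂ hK₂]
  exact sigmaC_eq_of_quasiIso X (min a₁ a₂) (max b₁ b₂) hK₁ hK₂ f q x x' h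

include f in
/-- **`I`-semiregularity is transported along a quasi-isomorphism of strictly perfect models** (each in its own window).
[cite: BuchweitzFlenner2003, §5 (I-semiregular)] -/
theorem isISemiregularC_iff_of_quasiIso' (I : Set ℕ) : IsISemiregularC X K₁ a₁ b₁ hK₁ I ↔ IsISemiregularC X K₂ a₂ b₂ hK₂ I := by
  haveI := K₁.isStrictlyGE_of_ge (min a₁ a₂) a₁ (min_le_left _ _)
  haveI := K₁.isStrictlyLE_of_le b₁ (max b₁ b₂) (le_max_left _ _)
  haveI := K₂.isStrictlyGE_of_ge (min a₁ a₂) a₂ (min_le_right _ _)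
  haveI := K₂.isStrictlyLE_of_le b₂ (max b₁ b₂) (le_max_right _ _)
  rw [isISemiregularC_iff_of_window X K₁ (min a₁ a₂) (max b₁ b₂) a₁ b₁ hK₁,
    isISemiregularC_iff_of_window X K₂ (min a₁ a₂) (max b₁ b₂) a₂ b₂ hK₂]
  exact isISemiregularC_iff_of_quasiIso X (min a₁ a₂) (max b₁ b₂) hK₁ hK₂ f I

include f in
/-- `q`-semiregularity is transported along a quasi-isomorphism of strictly perfect models (each in its own window).
[cite: BuchweitzFlenner2003, Def. 4.1] -/
theorem isSemiregularC_iff_of_quasiIso' (q : ℕ) : IsSemiregularC X K₁ a₁ b₁ hK₁ q ↔ IsSemiregularC X K₂ a₂ b₂ hK₂ q := by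
  rw [isSemiregularC_iff_isISemiregularC_singleton, isSemiregularC_iff_isISemiregularC_singleton]
  exact isISemiregularC_iff_of_quasiIso' X a₁ b₁ a₂ b₂ hK₁ hK₂ f {q}

end QuasiIsoWindows

end HomComplex

end Literature.AlgebraicGeometry.HodgeTheory

end
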